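import Summits.MatrixMultiplication.Statement
import Summits.MatrixMultiplication.MatrixMultiplication.Theorems.AsymptoticSpectrumMonotone

/-!
# MatrixMultiplication / RectangularAlpha — splitting the middle dimension

Route `MatrixMultiplication/RectangularAlpha`, item `stmt-MatrixMultiplication-0608` (rank 4):
`R(⟨n, m·k, n⟩) ≤ k · R(⟨n, m, n⟩)` over any field (indeed any commutative semiring).
The tensor `⟨n, m·k, n⟩` is the sum of `k` copies of `⟨n, m, n⟩` supported on the disjoint middle
blocks `Fin m × {j} ⊂ Fin m × Fin k ≃ Fin (m·k)` (`finProdFinEquiv`), and an optimal triad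
decomposition of `⟨n, m, n⟩` (which exists: finite index types, `exists_eq_sum_triad`) copied onto
each block gives a decomposition of `⟨n, m·k, n⟩` with `k · R(⟨n,m,n⟩)` triads
(Bläser 2013, §5/§7: additivity upper bound `R(t ⊕ t') ≤ R(t) + R(t')`). Degenerate cases
`k = 0` or `m = 0` (empty middle index type, zero tensor, rank `0`) are covered by the same proof.
-/

noncomputable section

open scoped BigOperators

namespace Literature.CplxAlg

universe u

section MatMul

variable (K : Type u) [CommSemiring K]

/-- Splitting the middle dimension: `R(⟨n, m·k, n⟩) ≤ k · R(⟨n, m, n⟩)` over any commutative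
semiring — `⟨n, m·k, n⟩` is a direct sum of `k` block copies of `⟨n, m, n⟩` and rank is
subadditive (Bläser 2013, §5, §7). [cite: Blaser2013, §7] -/
theorem tensorRank_matMulTensor_split_middle (n m k : ℕ) :
    Literature.Computability.AlgebraicComplexity.tensorRank (Literature.Computability.AlgebraicComplexity.matMulTensor K n (m * k) n) ≤ k * Literature.Computability.AlgebraicComplexity.tensorRank (Literature.Computability.AlgebraicComplexity.matMulTensor K n m n) := by
  classical
  set S : Set ℕ := {r : ℕ | ∃ (w : Fin r → Fin n × Fin n → K) (u : Fin r → Fin n × Fin m → K)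
      (v : Fin r → Fin m × Fin n → K), Literature.Computability.AlgebraicComplexity.matMulTensor K n m n = ∑ i, Literature.Computability.AlgebraicComplexity.triad (w i) (u i) (v i)}
    with hS
  have hSne : S.Nonempty := by
    obtain ⟨r, w, u, v, e⟩ := exists_eq_sum_triad (Literature.Computability.AlgebraicComplexity.matMulTensor K n m n)
    exact ⟨r, w, u, v, e⟩
  obtain ⟨w, u, v, hdec⟩ := Nat.sInf_mem hSne
  have hR : Literature.Computability.AlgebraicComplexity.tensorRank (Literature.Computability.AlgebraicComplexity.matMulTensor K n m n) = sInf S := rfl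
  rw [hR]
  set e : Fin (m * k) ≃ Fin m × Fin k := finProdFinEquiv.symm with he
  have hcard : Fintype.card (Fin k × Fin (sInf S)) = k * sInf S := by simp
  rw [← hcard]
  refine Literature.Computability.AlgebraicComplexity.tensorRank_le_card_of_eq_sum
    (fun p : Fin k × Fin (sInf S) => w p.2)
    (fun p b => if (e b.2).2 = p.1 then u p.2 (b.1, (e b.2).1) else 0)
    (fun p c => if (e c.1).2 = p.1 then v p.2 ((e c.1).1, c.2) else 0) ?_
  funext a b c
  rw [Finset.sum_apply, Finset.sum_apply, Finset.sum_apply, Fintype.sum_prod_type]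
  simp only [Literature.Computability.AlgebraicComplexity.triad_apply]
  have key : ∀ (b' : Fin n × Fin m) (c' : Fin m × Fin n),
      ∑ i, w i a * u i b' * v i c' = Literature.Computability.AlgebraicComplexity.matMulTensor K n m n a b' c' := by
    intro b' c'
    rw [hdec, Finset.sum_apply, Finset.sum_apply, Finset.sum_apply]
    simp only [Literature.Computability.AlgebraicComplexity.triad_apply]
  rw [Finset.sum_eq_single (e b.2).2]
  · by_cases hc : (e c.1).2 = (e b.2).2
    · simp only [hc, if_true]
      rw [key]
      have hiff : b.2 = c.1 ↔ (e b.2).1 = (e c.1).1 := by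
        constructor
        · intro h; rw [h]
        · intro h; apply e.injective; exact Prod.ext h (hc.symm)
      simp only [Literature.Computability.AlgebraicComplexity.matMulTensor, hiff]
    · have h2 : b.2 ≠ c.1 := fun h => hc (by rw [h])
      simp [hc, Literature.Computability.AlgebraicComplexity.matMulTensor, h2]
  · intro j _ hj
    simp [Ne.symm hj]
  · intro h; exact absurd (Finset.mem_univ _) h


/-- Settles `stmt-MatrixMultiplication-0608` (exact signature, fields): splitting the middle
dimension, `R(⟨n, m·k, n⟩) ≤ k · R(⟨n, m, n⟩)`. [cite: Blaser2013, §7] -/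
theorem tensorRank_matMulTensor_split_middle_sig :
    ∀ (K : Type) [Field K] (n m k : ℕ),
      Literature.Computability.AlgebraicComplexity.tensorRank (Literature.Computability.AlgebraicComplexity.matMulTensor K n (m * k) n) ≤
        k * Literature.Computability.AlgebraicComplexity.tensorRank (Literature.Computability.AlgebraicComplexity.matMulTensor K n m n) :=
  fun K _ n m k => tensorRank_matMulTensor_split_middle K n m k

end MatMul

end Literature.CplxAlg
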